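import Literature.NumberTheory.Automorphic.IdeleClassGroup
import Literature.Topology.Algebra.RestrictedProduct.Units
import HarnessLib

/-!
# The maps `K_∞ˣ → C_K`, `(∏_v 𝒪_v)ˣ → C_K`, and the openness of `K_∞ˣ × (∏_v 𝒪_v)ˣ → C_K`

Topic `NumberTheory/Automorphic`; namespace `Literature.NumberTheory.Automorphic`. Everything is
over Mathlib's `NumberField.AdeleRing (𝓞 K) K = InfiniteAdeleRing K × FiniteAdeleRing (𝓞 K) K`, the
tree's idele group `GaloisRepresentations.ideleGroup K = 𝔸_Kˣ`, principal ideles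
`GaloisRepresentations.principalIdeles K` and idele class group `IdeleClassGroup K = 𝔸_Kˣ ⧸ Kˣ`
(`Literature/NumberTheory/Automorphic/IdeleClassGroup.lean`).

* `integralAdeles K = ∏_v 𝒪_v` (product topology), `integralAdeles.structureRingHom K :
  ∏_v 𝒪_v →+* 𝔸_{K,f}` (Mathlib's `RestrictedProduct.structureMap` as a ring homomorphism) — an open
  embedding, and so is the induced map on units `(∏_v 𝒪_v)ˣ → 𝔸_{K,f}ˣ` for the units topologies
  (`isOpenEmbedding_unitsMap_structureRingHom`, from the tree's
  `Literature.Topology.Algebra.RestrictedProduct.Units.isOpenEmbedding_map`);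
* `ideleGroupSplit K : 𝔸_Kˣ ≃ₜ K_∞ˣ × 𝔸_{K,f}ˣ` (`Homeomorph.prodUnits`) and
  `ideleGroupEquiv K : 𝔸_Kˣ ≃ₜ K_∞ˣ × Πʳ_v [(K_v)ˣ, 𝒪_vˣ]` (with the tree's `finiteAdeleUnitsEquiv`:
  the ideles ARE a restricted product, topologically);
* `intUnitsToIdele` (`u ↦ (1, u)`; the infinite counterpart `x ↦ (x, 1)` is the tree's
  `GaloisRepresentations.infiniteIdeles K`, `HeckeCharacter.lean`), `infUnitsToClass`,
  `intUnitsToClass` (followed by `𝔸_Kˣ → C_K`), all continuous (the image of `intUnitsToIdele`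
  lies in the tree's unit ideles `GaloisRepresentations.unitIdeles K`, `UnitIdeles.lean`);
* **`isOpenEmbedding_infUnits_mul_intUnits_idele`**: `(x, u) ↦ (x, u) : K_∞ˣ × (∏_v 𝒪_v)ˣ → 𝔸_Kˣ`
  is an open embedding, hence **`isOpenMap_infUnits_mul_intUnits`**: `(x, u) ↦ [x]·[u] :
  K_∞ˣ × (∏_v 𝒪_v)ˣ → C_K` is an OPEN MAP (`𝔸_Kˣ → C_K` is open), with the neighbourhood form
  `image_infUnits_mul_intUnits_mem_nhds`. This is the openness input for extending characters from
  subgroups of `C_K` containing `[K_∞ˣ]`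
  (`Literature.Topology.Algebra.exists_continuous_circleChar_extension_of_isOpenMap_mul`).

Standard: J. W. S. Cassels, "Global fields", in Cassels–Fröhlich (1967), Ch. II §§14–16 (the idele
topology; `∏_v 𝒪_vˣ × K_∞ˣ` is an open subgroup of `J_K`) [CasselsFrohlichANT1967]; A. Weil, *Basic
Number Theory* (1967), Ch. IV §3 [WeilBNT1967]. Everything is proved (Mathlib + the two tree files
imported); no instances.

## Provenance

Reproduced for the tree under the LEAN-IN-TREE rule (2026-08-18) from the pub-hodgecm cell's
package files `HodgeCM/PerL34/IdeleClassGroup.lean` §§2–3 (DAG-node prover #10 lineage, seat pv10,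
gate run 20; 235 lines — its §1 `Units` lemmas are already in the tree's
`Literature/Topology/Algebra/RestrictedProduct/Units.lean`, its `ideleGroup` / `principalIdeles` /
`IdeleClassGroup` are the tree's (same definitions), its `infUnitsToIdele` is the tree's
`GaloisRepresentations.infiniteIdeles` (`infiniteIdeles_eq_symm_apply`), its
`UnitaryHeckeCharacter K` is spelled out as `IdeleClassGroup K →ₜ* Circle` downstream) and
`HodgeCM/PerL34/RestrictedUnits.lean` ll. 225–234 (prover #09 lineage, seat pv09-g4:
`ideleGroupEquiv`), verbatim up to these re-basings, the namespace, and the added docstrings /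
tags.
-/

set_option autoImplicit false

noncomputable section

open _root_.Topology Filter Set
open NumberField IsDedekindDomain IsDedekindDomain.HeightOneSpectrum
open scoped RestrictedProduct

namespace Literature.NumberTheory.Automorphic

open Literature.Topology.Algebra.RestrictedProduct (finiteAdeleUnitsEquiv)

/-! ## Integral adeles and the splitting `𝔸_Kˣ ≃ₜ K_∞ˣ × 𝔸_{K,f}ˣ` -/

section ideles

variable (K : Type*) [Field K] [NumberField K]

/-- `∏_v 𝒪_v` over the finite places of `K` (product topology; a compact open subring of `𝔸_{K,f}`
under the structure map). [folklore] -/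
abbrev integralAdeles : Type _ := Π v : HeightOneSpectrum (𝓞 K), v.adicCompletionIntegers K

/-- The inclusion `∏_v 𝒪_v → 𝔸_{K,f}` (Mathlib's `RestrictedProduct.structureMap`) as a ring
homomorphism. [folklore] -/
def integralAdeles.structureRingHom : integralAdeles K →+* FiniteAdeleRing (𝓞 K) K where
  toFun := RestrictedProduct.structureMap _ _ _
  map_one' := rfl
  map_mul' _ _ := rfl
  map_zero' := rfl
  map_add' _ _ := rfl

/-- Components of `structureRingHom` (definitional). [folklore] -/
theorem integralAdeles.structureRingHom_apply (x : integralAdeles K) (v : HeightOneSpectrum (𝓞 K)) :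
    integralAdeles.structureRingHom K x v = (x v : v.adicCompletion K) := rfl

/-- `∏_v 𝒪_v → 𝔸_{K,f}` is an open embedding (`RestrictedProduct.isOpenEmbedding_structureMap`,
the `𝒪_v` being open). [folklore] -/
theorem integralAdeles.isOpenEmbedding_structureRingHom :
    IsOpenEmbedding (integralAdeles.structureRingHom K) :=
  RestrictedProduct.isOpenEmbedding_structureMap (fun _ => Valued.isOpen_valuationSubring _)

/-- `(∏_v 𝒪_v)ˣ → 𝔸_{K,f}ˣ` is an open embedding (units topologies).
[cite: CasselsFrohlichANT1967, Ch. II §16] -/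
theorem integralAdeles.isOpenEmbedding_unitsMap_structureRingHom :
    IsOpenEmbedding (Units.map
      (integralAdeles.structureRingHom K : integralAdeles K →* FiniteAdeleRing (𝓞 K) K)) :=
  Literature.Topology.Algebra.RestrictedProduct.Units.isOpenEmbedding_map _
    (integralAdeles.isOpenEmbedding_structureRingHom K)

/-- `𝔸_Kˣ ≃ₜ K_∞ˣ × 𝔸_{K,f}ˣ` (`Homeomorph.prodUnits`). [folklore] -/
def ideleGroupSplit :
    GaloisRepresentations.ideleGroup K ≃ₜ (InfiniteAdeleRing K)ˣ × (FiniteAdeleRing (𝓞 K) K)ˣ :=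
  Homeomorph.prodUnits

/-- The same splitting as a group isomorphism (`MulEquiv.prodUnits`). [folklore] -/
def ideleGroupSplitMulEquiv :
    GaloisRepresentations.ideleGroup K ≃* (InfiniteAdeleRing K)ˣ × (FiniteAdeleRing (𝓞 K) K)ˣ :=
  MulEquiv.prodUnits

/-- `ideleGroupSplit` and `ideleGroupSplitMulEquiv` agree (definitional). [folklore] -/
theorem ideleGroupSplit_apply (x : GaloisRepresentations.ideleGroup K) :
    ideleGroupSplit K x = ideleGroupSplitMulEquiv K x := rfl

/-- **The ideles are a restricted product, topologically**:
`𝔸_Kˣ ≃ₜ K_∞ˣ × Πʳ_v [(K_v)ˣ, 𝒪_vˣ]` (the tree's `finiteAdeleUnitsEquiv` on the finite part).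
[cite: CasselsFrohlichANT1967, Ch. II §16] -/
def ideleGroupEquiv :
    GaloisRepresentations.ideleGroup K ≃ₜ (InfiniteAdeleRing K)ˣ ×
      Πʳ v : HeightOneSpectrum (𝓞 K), [(v.adicCompletion K)ˣ,
        (Submonoid.ofClass (v.adicCompletionIntegers K)).units] :=
  (ideleGroupSplit K).trans
    ((Homeomorph.refl _).prodCongr (finiteAdeleUnitsEquiv (𝓞 K) K).toHomeomorph)

/-- Finite components of `ideleGroupEquiv` (definitional). [folklore] -/
theorem ideleGroupEquiv_snd_apply (x : GaloisRepresentations.ideleGroup K)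
    (v : HeightOneSpectrum (𝓞 K)) :
    (((ideleGroupEquiv K x).2 v : (v.adicCompletion K)ˣ) : v.adicCompletion K) =
      (x : AdeleRing (𝓞 K) K).2 v := rfl

/-! ## `K_∞ˣ → 𝔸_Kˣ` (the tree's `GaloisRepresentations.infiniteIdeles`), `(∏_v 𝒪_v)ˣ → 𝔸_Kˣ` -/

/-- The tree's `infiniteIdeles K : K_∞ˣ → 𝔸_Kˣ` (`Units.map inl`) is `x ↦ split⁻¹ (x, 1)`.
[folklore] -/
theorem infiniteIdeles_eq_symm_apply (x : (InfiniteAdeleRing K)ˣ) :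
    GaloisRepresentations.infiniteIdeles K x = (ideleGroupSplitMulEquiv K).symm (x, 1) :=
  Units.ext rfl

/-- `infiniteIdeles = split⁻¹ ∘ inl` as homomorphisms. [folklore] -/
theorem infiniteIdeles_eq_comp_inl :
    GaloisRepresentations.infiniteIdeles K =
      (ideleGroupSplitMulEquiv K).symm.toMonoidHom.comp (MonoidHom.inl _ _) :=
  MonoidHom.ext fun x => infiniteIdeles_eq_symm_apply K x

/-- `(∏_v 𝒪_v)ˣ → 𝔸_Kˣ`, `u ↦ (1, u)`. [folklore] -/
def intUnitsToIdele : (integralAdeles K)ˣ →* GaloisRepresentations.ideleGroup K :=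
  (ideleGroupSplitMulEquiv K).symm.toMonoidHom.comp
    ((MonoidHom.inr _ _).comp
      (Units.map (integralAdeles.structureRingHom K : integralAdeles K →* FiniteAdeleRing (𝓞 K) K)))

/-- `(x, 1) · (1, u) = split⁻¹ (x, u)`. [folklore] -/
theorem infiniteIdeles_mul_intUnitsToIdele (x : (InfiniteAdeleRing K)ˣ) (u : (integralAdeles K)ˣ) :
    GaloisRepresentations.infiniteIdeles K x * intUnitsToIdele K u =
      (ideleGroupSplitMulEquiv K).symm
        (x, Units.map
          (integralAdeles.structureRingHom K : integralAdeles K →* FiniteAdeleRing (𝓞 K) K) u) := by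
  rw [infiniteIdeles_eq_comp_inl]
  simp only [intUnitsToIdele, MonoidHom.coe_comp, MulEquiv.coe_toMonoidHom,
    Function.comp_apply, MonoidHom.inl_apply, MonoidHom.inr_apply, ← map_mul, Prod.mk_mul_mk,
    mul_one, one_mul]

/-- The map `(x, u) ↦ (x, 1)·(1, u) : K_∞ˣ × (∏_v 𝒪_v)ˣ → 𝔸_Kˣ` is
`split⁻¹ ∘ (id × units (structure map))`. [folklore] -/
theorem infUnits_mul_intUnits_eq :
    (fun p : (InfiniteAdeleRing K)ˣ × (integralAdeles K)ˣ =>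
        GaloisRepresentations.infiniteIdeles K p.1 * intUnitsToIdele K p.2) =
      (ideleGroupSplit K).symm ∘
        Prod.map id (Units.map
          (integralAdeles.structureRingHom K : integralAdeles K →* FiniteAdeleRing (𝓞 K) K)) := by
  funext p
  rw [infiniteIdeles_mul_intUnitsToIdele]
  rfl

/-- `K_∞ˣ × (∏_v 𝒪_v)ˣ → 𝔸_Kˣ`, `(x, u) ↦ (x, u)`, is an open map.
[cite: CasselsFrohlichANT1967, Ch. II §16] -/
theorem isOpenMap_infUnits_mul_intUnits_idele :
    IsOpenMap (fun p : (InfiniteAdeleRing K)ˣ × (integralAdeles K)ˣ =>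
      GaloisRepresentations.infiniteIdeles K p.1 * intUnitsToIdele K p.2) := by
  rw [infUnits_mul_intUnits_eq]
  exact (ideleGroupSplit K).symm.isOpenMap.comp
    (IsOpenMap.id.prodMap (integralAdeles.isOpenEmbedding_unitsMap_structureRingHom K).isOpenMap)

/-- `K_∞ˣ × (∏_v 𝒪_v)ˣ → 𝔸_Kˣ` is an open embedding: **`K_∞ˣ × ∏_v 𝒪_vˣ` is an open subgroup of
the idele group**. [cite: CasselsFrohlichANT1967, Ch. II §16] -/
theorem isOpenEmbedding_infUnits_mul_intUnits_idele :
    IsOpenEmbedding (fun p : (InfiniteAdeleRing K)ˣ × (integralAdeles K)ˣ =>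
      GaloisRepresentations.infiniteIdeles K p.1 * intUnitsToIdele K p.2) := by
  rw [infUnits_mul_intUnits_eq]
  exact (ideleGroupSplit K).symm.isOpenEmbedding.comp
    (IsOpenEmbedding.id.prodMap (integralAdeles.isOpenEmbedding_unitsMap_structureRingHom K))

/-- `infiniteIdeles` is continuous. [folklore] -/
theorem continuous_infiniteIdeles : Continuous (GaloisRepresentations.infiniteIdeles K) := by
  rw [infiniteIdeles_eq_comp_inl]
  exact (ideleGroupSplit K).symm.continuous.comp (continuous_id.prodMk continuous_const)

/-- `intUnitsToIdele` is continuous. [folklore] -/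
theorem continuous_intUnitsToIdele : Continuous (intUnitsToIdele K) :=
  (ideleGroupSplit K).symm.continuous.comp
    (continuous_const.prodMk
      ((integralAdeles.isOpenEmbedding_unitsMap_structureRingHom K).continuous))

end ideles

/-! ## `K_∞ˣ → C_K`, `(∏_v 𝒪_v)ˣ → C_K` and the openness of `(x, u) ↦ [x]·[u]` -/

section classes

variable (K : Type) [Field K] [NumberField K]

/-- `K_∞ˣ → C_K` (classes of the infinite ideles). [folklore] -/
def infUnitsToClass : (InfiniteAdeleRing K)ˣ →* IdeleClassGroup K :=
  (QuotientGroup.mk' (GaloisRepresentations.principalIdeles K)).comp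
    (GaloisRepresentations.infiniteIdeles K)

/-- `(∏_v 𝒪_v)ˣ → C_K`. [folklore] -/
def intUnitsToClass : (integralAdeles K)ˣ →* IdeleClassGroup K :=
  (QuotientGroup.mk' (GaloisRepresentations.principalIdeles K)).comp (intUnitsToIdele K)

/-- `infUnitsToClass = mk ∘ infiniteIdeles` (definitional). [folklore] -/
theorem infUnitsToClass_apply (x : (InfiniteAdeleRing K)ˣ) :
    infUnitsToClass K x = (GaloisRepresentations.infiniteIdeles K x : IdeleClassGroup K) := rfl

/-- `intUnitsToClass = mk ∘ intUnitsToIdele` (definitional). [folklore] -/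
theorem intUnitsToClass_apply (u : (integralAdeles K)ˣ) :
    intUnitsToClass K u = (intUnitsToIdele K u : IdeleClassGroup K) := rfl

/-- `infUnitsToClass` is continuous. [folklore] -/
theorem continuous_infUnitsToClass : Continuous (infUnitsToClass K) :=
  QuotientGroup.continuous_mk.comp (continuous_infiniteIdeles K)

/-- `intUnitsToClass` is continuous. [folklore] -/
theorem continuous_intUnitsToClass : Continuous (intUnitsToClass K) :=
  QuotientGroup.continuous_mk.comp (continuous_intUnitsToIdele K)

/-- **`(x, u) ↦ [x]·[u] : K_∞ˣ × (∏_v 𝒪_v)ˣ → C_K` is an open map** (open embedding into `𝔸_Kˣ`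
followed by the open quotient map `𝔸_Kˣ → C_K`). [cite: CasselsFrohlichANT1967, Ch. II §16] -/
theorem isOpenMap_infUnits_mul_intUnits :
    IsOpenMap (fun p : (InfiniteAdeleRing K)ˣ × (integralAdeles K)ˣ =>
      infUnitsToClass K p.1 * intUnitsToClass K p.2) := by
  have h : (fun p : (InfiniteAdeleRing K)ˣ × (integralAdeles K)ˣ =>
        infUnitsToClass K p.1 * intUnitsToClass K p.2) =
      (QuotientGroup.mk : GaloisRepresentations.ideleGroup K → IdeleClassGroup K) ∘
        (fun p => GaloisRepresentations.infiniteIdeles K p.1 * intUnitsToIdele K p.2) := by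
    funext p
    simp only [infUnitsToClass, intUnitsToClass, MonoidHom.coe_comp, Function.comp_apply,
      QuotientGroup.mk'_apply, QuotientGroup.mk_mul]
  rw [h]
  exact QuotientGroup.isOpenMap_coe.comp (isOpenMap_infUnits_mul_intUnits_idele K)

/-- Neighbourhood form: the image of a neighbourhood of `1` in `K_∞ˣ × (∏_v 𝒪_v)ˣ` under
`(x, u) ↦ [x]·[u]` is a neighbourhood of `1` in `C_K`. [cite: CasselsFrohlichANT1967, Ch. II §16] -/
theorem image_infUnits_mul_intUnits_mem_nhds
    {s : Set ((InfiniteAdeleRing K)ˣ × (integralAdeles K)ˣ)}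
    (hs : s ∈ 𝓝 ((1 : (InfiniteAdeleRing K)ˣ), (1 : (integralAdeles K)ˣ))) :
    (fun p : (InfiniteAdeleRing K)ˣ × (integralAdeles K)ˣ =>
        infUnitsToClass K p.1 * intUnitsToClass K p.2) '' s ∈ 𝓝 (1 : IdeleClassGroup K) := by
  have h := (isOpenMap_infUnits_mul_intUnits K).image_mem_nhds hs
  have h1 : infUnitsToClass K ((1 : (InfiniteAdeleRing K)ˣ), (1 : (integralAdeles K)ˣ)).1 *
      intUnitsToClass K ((1 : (InfiniteAdeleRing K)ˣ), (1 : (integralAdeles K)ˣ)).2 =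
        (1 : IdeleClassGroup K) := by
    rw [map_one, map_one]
    exact mul_one (1 : IdeleClassGroup K)
  rwa [h1] at h

end classes

end Literature.NumberTheory.Automorphic

end
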